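import Mathlib
import HarnessLib
import Literature.Probability.LatticeModels.ScalingLimit3D
import Literature.Probability.LatticeModels.DolanOsbornBlocks
import Literature.Probability.LatticeModels.ConformalBootstrap
import Summits.CriticalPhenomena.Ising3DConformalLimit.Theses.ClusterRigidity

/-!
# Sketch — crux-ideate round 1, ideator 2, crux `ClusterSetTotallyDisconnected` (stmt-CriticalPhenomena-4659)

First lemmas of the two idea cards, typed over existing declarations:

* card `sierpinski-gap-cover`: `CoverLemma` (Sierpiński/boundary-bumping covering theorem) and the
  proved glue `crux_of_cover`, `crux_of_pointwise_gap`, `crux_of_classwise` (automatic cover);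
* card `one-model-one-spectrum`: `IsPositiveCrossingSolution`, `SupportUnique`,
  `SigmaUnique`, `HasBlockDecomposition`, the stubs `ClusterPointsSupportUnique` (C1), `CommonSpectrum` (L2),
  `OneModelOneSpectrum` (Σ-form), `LatticeSpectrumRegular` (L1) and the proved glue
  `fourPoint_eq_of_common_of_unique`, `fourPoint_eq_of_oneModel`.

Nothing here is filed as an item; it only certifies that the first lemmas elaborate.
-/

noncomputable section

namespace Summit.CriticalPhenomena.Ising3DConformalLimit.Cruxes.ClusterSetTotallyDisconnected.Ideator2

open Literature.Probability.LatticeModels Filter Set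
open scoped Topology

/-! ## Vocabulary (verbatim the crux's) -/

/-- The forced renormalisation `ρ★(δ) := ⟨σ₀ σ_{⌊δ⁻¹⌋ e₁}⟩_{β_c(3)}^{-1/2}`. -/
def rhoStar : ℝ → ℝ := fun δ : ℝ => (criticalTwoPoint 3 (Pi.single 0 ⌊δ⁻¹⌋)) ^ (-(1/2:ℝ))

/-- The cluster set `𝒞` of the self-normalised critical zoom (verbatim the crux's set-builder). -/
def clusterSet : Set (CorrFamily 3) :=
  {S | (∀ n x, x ∉ NonCoincident 3 n → S n x = 0) ∧ ∃ u : ℕ → ℝ, (∀ k, u k ∈ Set.Ioc (0:ℝ) 1) ∧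
    Filter.Tendsto u Filter.atTop (nhds 0) ∧ ∀ n, TendstoLocallyUniformlyOn
      (fun k => rescaledCorrelator (criticalCorr 3) rhoStar n (u k)) (S n) Filter.atTop
      (NonCoincident 3 n)}

/-- The crux read through the vocabulary (definitional). -/
theorem crux_iff :
    Summit.CriticalPhenomena.Ising3DConformalLimit.Theses.ClusterRigidity.ClusterSetTotallyDisconnected ↔
      IsTotallyDisconnected clusterSet :=
  Iff.rfl

/-! ## Card `sierpinski-gap-cover` — first lemma and glue -/

/-- FIRST LEMMA (Sierpiński 1918 / boundary bumping, covering form): in a Hausdorff space, a compact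
set covered by countably many CLOSED, TOTALLY DISCONNECTED sets is totally disconnected. (Proof
sketch: a preconnected `t ⊆ s` with two points has compact connected Hausdorff closure `t̄ ⊆ s`;
Baire (`nonempty_interior_of_iUnion_of_closed`) gives an `m` with `K m ∩ t̄` of non-empty interior
in `t̄`; boundary bumping produces a non-degenerate subcontinuum of `t̄` inside `K m`,
contradicting total disconnectedness of `K m`.) No separation BETWEEN the classes `K m` is asked. -/
def CoverLemma : Prop :=
  ∀ (X : Type) [TopologicalSpace X] [T2Space X] (ι : Type) [Countable ι] (s : Set X) (K : ι → Set X),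
    IsCompact s → (∀ m, IsClosed (K m)) → (∀ m, IsTotallyDisconnected (K m)) →
    s ⊆ ⋃ m, K m → IsTotallyDisconnected s

/-- GLUE (proved): the crux follows once the cluster set sits inside a compact set covered by
countably many closed totally disconnected classes. -/
theorem crux_of_cover (hCL : CoverLemma) {ι : Type} [Countable ι] (I : Set (CorrFamily 3))
    (hI : IsCompact I) (K : ι → Set (CorrFamily 3)) (hKc : ∀ m, IsClosed (K m))
    (hKtd : ∀ m, IsTotallyDisconnected (K m)) (hcov : I ⊆ ⋃ m, K m) (hC : clusterSet ⊆ I) :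
    Summit.CriticalPhenomena.Ising3DConformalLimit.Theses.ClusterRigidity.ClusterSetTotallyDisconnected := by
  rw [crux_iff]
  intro t ht hpre
  exact hCL (CorrFamily 3) ι I K hI hKc hKtd hcov t (ht.trans hC) hpre

/-- GLUE (proved), POINTWISE-GAP FORM: if every member of a compact admissible class `I ⊇ 𝒞` has SOME
positive "gap" `γ S > 0` (no uniformity), the super-level sets `{γ ≥ 1/(m+1)}` are closed (upper
semicontinuity of the gap), and rigidity is known CLASS BY CLASS (each `I ∩ {γ ≥ 1/(m+1)}` totally
disconnected — the form in which uniform-gap isolation theorems are stated), then the crux holds. -/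
theorem crux_of_pointwise_gap (hCL : CoverLemma) (I : Set (CorrFamily 3)) (hI : IsCompact I)
    (hIc : IsClosed I) (γ : CorrFamily 3 → ℝ)
    (hγ : ∀ m : ℕ, IsClosed {S : CorrFamily 3 | (1:ℝ) / (m + 1) ≤ γ S})
    (htd : ∀ m : ℕ, IsTotallyDisconnected (I ∩ {S : CorrFamily 3 | (1:ℝ) / (m + 1) ≤ γ S}))
    (hpos : ∀ S ∈ I, 0 < γ S) (hC : clusterSet ⊆ I) :
    Summit.CriticalPhenomena.Ising3DConformalLimit.Theses.ClusterRigidity.ClusterSetTotallyDisconnected := by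
  refine crux_of_cover hCL I hI (fun m : ℕ => I ∩ {S | (1:ℝ) / (m + 1) ≤ γ S})
    (fun m => hIc.inter (hγ m)) htd ?_ hC
  intro S hS
  obtain ⟨m, hm⟩ := exists_nat_one_div_lt (hpos S hS)
  exact Set.mem_iUnion.mpr ⟨m, hS, hm.le⟩

/-- GLUE (proved), CLASSWISE FORM WITH AUTOMATIC COVER — the card's point. Take countably many
CONTINUOUS functionals `γ j` on the admissible class (e.g. `γ j S = U₄(S)` at the `j`-th configuration
of a countable dense set: evaluation at a fixed configuration is continuous in the product topology).
Then `I` is AUTOMATICALLY covered by the closed classes `K₀ = I ∩ {∀ j, γ j = 0}` (e.g. `U₄ ≡ 0`)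
and `K_{m,j} = I ∩ {|γ j| ≥ 1/(m+1)}` (UNIFORMLY non-degenerate classes); so total disconnectedness of
the crux's cluster set reduces to rigidity of `K₀` and of each uniform class SEPARATELY — uniform
lower bounds along the unknown set `𝒞` are never needed, and the classes may accumulate on `K₀`. -/
theorem crux_of_classwise (hCL : CoverLemma) (I : Set (CorrFamily 3)) (hI : IsCompact I)
    (hIc : IsClosed I) (γ : ℕ → CorrFamily 3 → ℝ) (hγc : ∀ j, Continuous (γ j))
    (h0 : IsTotallyDisconnected (I ∩ {S : CorrFamily 3 | ∀ j, γ j S = 0}))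
    (htd : ∀ m j : ℕ, IsTotallyDisconnected (I ∩ {S : CorrFamily 3 | (1:ℝ) / (m + 1) ≤ |γ j S|}))
    (hC : clusterSet ⊆ I) :
    Summit.CriticalPhenomena.Ising3DConformalLimit.Theses.ClusterRigidity.ClusterSetTotallyDisconnected := by
  classical
  let K : Option (ℕ × ℕ) → Set (CorrFamily 3) := fun o =>
    match o with
    | none => I ∩ {S | ∀ j, γ j S = 0}
    | some (m, j) => I ∩ {S | (1:ℝ) / (m + 1) ≤ |γ j S|}
  refine crux_of_cover hCL I hI K ?_ ?_ ?_ hC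
  · rintro (_ | ⟨m, j⟩)
    · change IsClosed (I ∩ {S | ∀ j, γ j S = 0})
      refine hIc.inter ?_
      have : {S : CorrFamily 3 | ∀ j, γ j S = 0} = ⋂ j, {S | γ j S = 0} := by
        ext S; simp
      rw [this]
      exact isClosed_iInter fun j => isClosed_eq (hγc j) continuous_const
    · change IsClosed (I ∩ {S | (1:ℝ) / (m + 1) ≤ |γ j S|})
      exact hIc.inter (isClosed_le continuous_const (continuous_abs.comp (hγc j)))
  · rintro (_ | ⟨m, j⟩)
    · exact h0
    · exact htd m j
  · intro S hS
    by_cases hz : ∀ j, γ j S = 0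
    · exact Set.mem_iUnion.mpr ⟨none, hS, hz⟩
    · simp only [not_forall] at hz
      obtain ⟨j, hj⟩ := hz
      obtain ⟨m, hm⟩ := exists_nat_one_div_lt (abs_pos.mpr hj)
      exact Set.mem_iUnion.mpr ⟨some (m, j), hS, hm.le⟩

/-- SUPPORT (proved): COMPACT CONTAINERS ARE FREE IN THE PRODUCT TOPOLOGY. Any pointwise box
`{S | ∀ n x, |S n x| ≤ M n x}` is compact (Tychonoff twice). Within a two-point fibre `S 2 = G`,
Newman's Gaussian-domination inequality (inherited by cluster points, a closed condition) bounds every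
`|S (2m) x|` by the hafnian of `G`, so the admissible container of a fibre is compact WITHOUT any
doubling / `UniformRegularity` input — the Baire argument of `CoverLemma` needs nothing from item 6150. -/
theorem isCompact_box (M : (n : ℕ) → (Fin n → EuclideanSpace ℝ (Fin 3)) → ℝ) :
    IsCompact {S : CorrFamily 3 | ∀ n x, |S n x| ≤ M n x} := by
  have h : {S : CorrFamily 3 | ∀ n x, |S n x| ≤ M n x} =
      Set.pi Set.univ (fun n => Set.pi Set.univ (fun x => Set.Icc (-(M n x)) (M n x))) := by
    ext S
    simp only [Set.mem_setOf_eq, Set.mem_univ_pi, Set.mem_Icc, abs_le]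
  rw [h]
  exact isCompact_univ_pi fun n => isCompact_univ_pi fun x => isCompact_Icc

/-- SUPPORT (proved): closed subsets of a box are compact containers — the shape in which the
admissible class `I` of `crux_of_classwise` is obtained (closed inherited constraints ∩ a box). -/
theorem isCompact_of_closed_subset_box {I : Set (CorrFamily 3)} (hI : IsClosed I)
    (M : (n : ℕ) → (Fin n → EuclideanSpace ℝ (Fin 3)) → ℝ)
    (hsub : I ⊆ {S : CorrFamily 3 | ∀ n x, |S n x| ≤ M n x}) : IsCompact I :=
  (isCompact_box M).of_isClosed_subset hI hsub

/-! ## Card `one-model-one-spectrum` — first lemmas and glue -/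

/-- The crossing vector `F_{Δ,ℓ}(u,v) = v^{Δ₀} g_{Δ,ℓ}(u,v) − u^{Δ₀} g_{Δ,ℓ}(v,u)` of a block at
external dimension `Δ₀`, indexed by `q = (Δ, ℓ)`. -/
def crossingVector (B : ConformalBlocks 3) (Δ₀ : ℝ) (q : ℝ × ℕ) (u v : ℝ) : ℝ :=
  v ^ Δ₀ * B.g q.1 q.2 u v - u ^ Δ₀ * B.g q.1 q.2 v u

/-- The stripped four-point function `g_p(u,v) = Σ_q p(q) g_q(u,v)` of a weight function `p` on
`(Δ, ℓ)`. -/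
def fourPoint (B : ConformalBlocks 3) (p : ℝ × ℕ → ℝ) (u v : ℝ) : ℝ :=
  ∑' q, p q * B.g q.1 q.2 u v

/-- `p : (Δ,ℓ) ↦ λ²` is a NONNEGATIVE, identity-normalised, unitary, summable solution of the crossing
sum rule of four identical scalars of dimension `Δ₀` (the convex body `𝒢_{Δ₀}` of the card; its
members need not come from a CFT). -/
def IsPositiveCrossingSolution (B : ConformalBlocks 3) (Δ₀ : ℝ) (p : ℝ × ℕ → ℝ) : Prop :=
  (∀ q, 0 ≤ p q) ∧ p (0, 0) = 1 ∧
  (∀ q, p q ≠ 0 → q ≠ (0, 0) → q.1 ∈ ConformalBlocks.blockDomain q.2) ∧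
  (∀ uv ∈ crossRatioSquare, Summable (fun q => p q * B.g q.1 q.2 uv.1 uv.2)) ∧
  ∀ uv ∈ crossRatioSquare,
    uv.2 ^ Δ₀ * fourPoint B p uv.1 uv.2 = uv.1 ^ Δ₀ * fourPoint B p uv.2 uv.1

/-- SUPPORT-UNIQUENESS of `p` ("`g_p` is an extreme point of `𝒢_{Δ₀}`"): no other positive crossing
solution is supported inside `supp p`. A LINEAR property: it holds iff the crossing vectors
`{F_q : q ∈ supp p}` admit at most one nonnegative relation `Σ p(q) F_q = −F_{(0,0)}`. -/
def SupportUnique (B : ConformalBlocks 3) (Δ₀ : ℝ) (p : ℝ × ℕ → ℝ) : Prop :=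
  ∀ p', IsPositiveCrossingSolution B Δ₀ p' → Function.support p' ⊆ Function.support p → p' = p

/-- `S` has the positive block decomposition `p` at external dimension `Δ₀`:
`S 4 x = (x₁₂ x₃₄)^{-2Δ₀} g_p(u,v)` whenever the cross-ratios lie in the convergence square. -/
def HasBlockDecomposition (B : ConformalBlocks 3) (S : CorrFamily 3) (Δ₀ : ℝ)
    (p : ℝ × ℕ → ℝ) : Prop :=
  IsPositiveCrossingSolution B Δ₀ p ∧
  ∀ x : Fin 4 → EuclideanSpace ℝ (Fin 3), (crossRatioU x, crossRatioV x) ∈ crossRatioSquare →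
    S 4 x = (‖x 0 - x 1‖ * ‖x 2 - x 3‖) ^ (-2 * Δ₀) * fourPoint B p (crossRatioU x) (crossRatioV x)

/-- STUB C1 (CFT side, linear): every cluster point that admits a positive block decomposition over
genuine Dolan–Osborn blocks is support-unique. -/
def ClusterPointsSupportUnique : Prop :=
  ∀ B : ConformalBlocks 3, B.IsDolanOsborn → ∀ S ∈ clusterSet, ∀ (Δ₀ : ℝ) (p : ℝ × ℕ → ℝ),
    HasBlockDecomposition B S Δ₀ p → SupportUnique B Δ₀ p

/-- STUB L2 (lattice ↔ continuum, "one model, one spectrum"): any two cluster points with block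
decompositions have the same external dimension and the same block SUPPORT (not the same weights —
that is the conclusion). Intended engine: the lattice spectrum `LatticeSpectrumRegular` +
mesoscopic fusion. -/
def CommonSpectrum : Prop :=
  ∀ B : ConformalBlocks 3, B.IsDolanOsborn → ∀ S ∈ clusterSet, ∀ S' ∈ clusterSet,
    ∀ (Δ₀ Δ₀' : ℝ) (p p' : ℝ × ℕ → ℝ),
    HasBlockDecomposition B S Δ₀ p → HasBlockDecomposition B S' Δ₀' p' →
    Δ₀ = Δ₀' ∧ Function.support p = Function.support p'

/-- GLUE (proved): common spectrum + support-uniqueness ⇒ any two decomposable cluster points have the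
same stripped four-point function, hence the same `S 4` on every configuration whose cross-ratios lie
in the convergence square. -/
theorem fourPoint_eq_of_common_of_unique (hU : ClusterPointsSupportUnique) (hC : CommonSpectrum)
    {B : ConformalBlocks 3} (hB : B.IsDolanOsborn) {S S' : CorrFamily 3} (hS : S ∈ clusterSet)
    (hS' : S' ∈ clusterSet) {Δ₀ Δ₀' : ℝ} {p p' : ℝ × ℕ → ℝ}
    (hp : HasBlockDecomposition B S Δ₀ p) (hp' : HasBlockDecomposition B S' Δ₀' p') :
    ∀ x : Fin 4 → EuclideanSpace ℝ (Fin 3),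
      (crossRatioU x, crossRatioV x) ∈ crossRatioSquare → S 4 x = S' 4 x := by
  obtain ⟨rfl, hsupp⟩ := hC B hB S hS S' hS' Δ₀ Δ₀' p p' hp hp'
  have hpp : p' = p :=
    hU B hB S hS Δ₀ p hp p' hp'.1 (fun q hq => by rw [hsupp]; exact hq)
  intro x hx
  rw [hp.2 x hx, hp'.2 x hx, hpp]

/-! ### Preferred (robust) form: uniqueness inside a COMMON index set `Σ` (the lattice spectrum)

`SupportUnique` compares a solution with those supported inside its own support, which is fragile
under accidental zeros of OPE coefficients. The card's primary statement quantifies a common index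
set `Σ ⊇ supp p_S` for all cluster points (intended: `Σ = Σ_latt`, the band-edge spectrum of the
lattice model) and asks uniqueness of the positive crossing solution INSIDE `Σ`. -/

/-- `Σ`-UNIQUENESS: at external dimension `Δ₀` there is at most one positive crossing solution
supported inside `Σ` (linear-algebraic: the crossing vectors `{F_q}_{q ∈ Σ}` together with `F_𝟙`
carry at most one nonnegative normalised relation). -/
def SigmaUnique (B : ConformalBlocks 3) (Δ₀ : ℝ) (Sig : Set (ℝ × ℕ)) : Prop :=
  ∀ p p', IsPositiveCrossingSolution B Δ₀ p → IsPositiveCrossingSolution B Δ₀ p' →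
    Function.support p ⊆ Sig → Function.support p' ⊆ Sig → p = p'

/-- ONE MODEL, ONE SPECTRUM (stubs L2 + C1 merged in `Σ`-form): there are a common index set `Σ`
and a common external dimension `Δ₀` such that every decomposable cluster point has external
dimension `Δ₀` and block support inside `Σ` (lattice side: `Σ = Σ_latt` via `LatticeSpectrumRegular`
+ mesoscopic fusion), and the positive crossing solution inside `Σ` is unique (CFT side: dual
analytic functionals). -/
def OneModelOneSpectrum : Prop :=
  ∀ B : ConformalBlocks 3, B.IsDolanOsborn → ∃ (Sig : Set (ℝ × ℕ)) (Δ₀ : ℝ),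
    (∀ S ∈ clusterSet, ∀ (Δ : ℝ) (p : ℝ × ℕ → ℝ), HasBlockDecomposition B S Δ p →
      Δ = Δ₀ ∧ Function.support p ⊆ Sig) ∧
    SigmaUnique B Δ₀ Sig

/-- GLUE (proved), `Σ`-form: any two decomposable cluster points have the same `S 4` on the square. -/
theorem fourPoint_eq_of_oneModel (h : OneModelOneSpectrum) {B : ConformalBlocks 3}
    (hB : B.IsDolanOsborn) {S S' : CorrFamily 3} (hS : S ∈ clusterSet) (hS' : S' ∈ clusterSet)
    {Δ Δ' : ℝ} {p p' : ℝ × ℕ → ℝ}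
    (hp : HasBlockDecomposition B S Δ p) (hp' : HasBlockDecomposition B S' Δ' p') :
    ∀ x : Fin 4 → EuclideanSpace ℝ (Fin 3),
      (crossRatioU x, crossRatioV x) ∈ crossRatioSquare → S 4 x = S' 4 x := by
  obtain ⟨Sig, Δ₀, hmem, huniq⟩ := h B hB
  obtain ⟨rfl, hsub⟩ := hmem S hS Δ p hp
  obtain ⟨rfl, hsub'⟩ := hmem S' hS' Δ' p' hp'
  have hpp : p = p' := huniq p p' hp.1 hp'.1 hsub hsub'
  intro x hx
  rw [hp.2 x hx, hp'.2 x hx, hpp]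

/-! ### The lattice spectrum (stub L1, diagonal leading-exponent form) -/

/-- Translate of a finite pattern `A ⊂ ℤ³` by `n e₀`. -/
def shiftPattern (A : Finset (Site 3)) (n : ℤ) : Finset (Site 3) :=
  A.image (fun x => x + Pi.single 0 n)

/-- Truncated axis autocorrelation `⟨σ_A ; σ_{A + n e₀}⟩⁺_{β_c(3)}` of the pattern field `σ_A`. -/
def patternAutocorr (A : Finset (Site 3)) (n : ℕ) : ℝ :=
  plusExpect 3 (criticalBeta 3) 0 (fun s => spinProduct A s * spinProduct (shiftPattern A n) s)
    - plusCorr 3 (criticalBeta 3) 0 A * plusCorr 3 (criticalBeta 3) 0 (shiftPattern A n)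

/-- STUB L1 (lattice, exponent-type): every local pattern field of the critical `ℤ³` Ising model has a
REGULARLY VARYING axis autocorrelation, `⟨σ_A;σ_{A+⌊tn⌋e₀}⟩/⟨σ_A;σ_{A+ne₀}⟩ → t^{-a(A)}`: the
band-edge exponent `a(A) = 2Δ(A)` of its Källén–Lehmann measure exists (no log-periodic wiggle).
For `A = {0}` this is convergence of the axis two-point zoom; the matrix (off-diagonal) version over
families of patterns defines the subleading exponents — the LATTICE SPECTRUM `Σ_latt`. -/
def LatticeSpectrumRegular : Prop :=
  ∀ A : Finset (Site 3), A.Nonempty → ∃ a : ℝ, 0 < a ∧ ∀ t : ℝ, 1 ≤ t →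
    Tendsto (fun n : ℕ => patternAutocorr A ⌊t * n⌋₊ / patternAutocorr A n) atTop (𝓝 (t ^ (-a)))

end Summit.CriticalPhenomena.Ising3DConformalLimit.Cruxes.ClusterSetTotallyDisconnected.Ideator2

end
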